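import Mathlib.Algebra.BigOperators.Group.Finset.Basic
import Mathlib.Data.Nat.Choose.Basic
import Mathlib.Tactic

/-!
# PercRepro — the numerals of the confinement count (p8 g12, S3): `Σ_{b ≤ 8 − ν} C(n − σ, b)·C(σ, 6 − b)` over the admissible
`(ν, σ)` grid `ν₀ ≤ ν ≤ 8`, `σ ≤ 3ν` at `n = 30` (the cell `(22, 8)`) and `n = 28` (its terminal `(20, 8)`). Each bound is the
exact maximum over the grid (attained at `(ν₀, 3ν₀)`, or at `ν = 8` by `C(24, 6)` when `ν₀ = 8`). Axioms: standard.
-/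

namespace PercRepro

namespace ThmN

/-- The confinement count at `n = 30`, `d = 8`, `ν ≥ 5`, `σ ≤ 3ν`: at most `400400`. -/
theorem confined_bound_30_8_5 (ν σ : ℕ) (hν0 : 5 ≤ ν) (hν8 : ν ≤ 8) (hσ : σ ≤ 3 * ν) (hσn : σ ≤ 30) :
    ∑ b ∈ Finset.range (8 - ν + 1), (30 - σ).choose b * σ.choose (6 - b) ≤ 400400 := by
  interval_cases ν <;> interval_cases σ <;> norm_num [Finset.sum_range_succ, Nat.choose]

/-- The confinement count at `n = 30`, `d = 8`, `ν ≥ 6`, `σ ≤ 3ν`: at most `323340`. -/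
theorem confined_bound_30_8_6 (ν σ : ℕ) (hν0 : 6 ≤ ν) (hν8 : ν ≤ 8) (hσ : σ ≤ 3 * ν) (hσn : σ ≤ 30) :
    ∑ b ∈ Finset.range (8 - ν + 1), (30 - σ).choose b * σ.choose (6 - b) ≤ 323340 := by
  interval_cases ν <;> interval_cases σ <;> norm_num [Finset.sum_range_succ, Nat.choose]

/-- The confinement count at `n = 30`, `d = 8`, `ν ≥ 7`, `σ ≤ 3ν`: at most `237405`. -/
theorem confined_bound_30_8_7 (ν σ : ℕ) (hν0 : 7 ≤ ν) (hν8 : ν ≤ 8) (hσ : σ ≤ 3 * ν) (hσn : σ ≤ 30) :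
    ∑ b ∈ Finset.range (8 - ν + 1), (30 - σ).choose b * σ.choose (6 - b) ≤ 237405 := by
  interval_cases ν <;> interval_cases σ <;> norm_num [Finset.sum_range_succ, Nat.choose]

/-- The confinement count at `n = 28`, `d = 8`, `ν ≥ 5`, `σ ≤ 3ν`: at most `280644`. -/
theorem confined_bound_28_8_5 (ν σ : ℕ) (hν0 : 5 ≤ ν) (hν8 : ν ≤ 8) (hσ : σ ≤ 3 * ν) (hσn : σ ≤ 28) :
    ∑ b ∈ Finset.range (8 - ν + 1), (28 - σ).choose b * σ.choose (6 - b) ≤ 280644 := by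
  interval_cases ν <;> interval_cases σ <;> norm_num [Finset.sum_range_succ, Nat.choose]

/-- The confinement count at `n = 28`, `d = 8`, `ν ≥ 6`, `σ ≤ 3ν`: at most `241944`. -/
theorem confined_bound_28_8_6 (ν σ : ℕ) (hν0 : 6 ≤ ν) (hν8 : ν ≤ 8) (hσ : σ ≤ 3 * ν) (hσn : σ ≤ 28) :
    ∑ b ∈ Finset.range (8 - ν + 1), (28 - σ).choose b * σ.choose (6 - b) ≤ 241944 := by
  interval_cases ν <;> interval_cases σ <;> norm_num [Finset.sum_range_succ, Nat.choose]

/-- The confinement count at `n = 28`, `d = 8`, `ν ≥ 7`, `σ ≤ 3ν`: at most `196707`. -/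
theorem confined_bound_28_8_7 (ν σ : ℕ) (hν0 : 7 ≤ ν) (hν8 : ν ≤ 8) (hσ : σ ≤ 3 * ν) (hσn : σ ≤ 28) :
    ∑ b ∈ Finset.range (8 - ν + 1), (28 - σ).choose b * σ.choose (6 - b) ≤ 196707 := by
  interval_cases ν <;> interval_cases σ <;> norm_num [Finset.sum_range_succ, Nat.choose]

/-- The confinement count at `n = 28`, `d = 8`, `ν ≥ 8`, `σ ≤ 3ν`: at most `134596`. -/
theorem confined_bound_28_8_8 (ν σ : ℕ) (hν0 : 8 ≤ ν) (hν8 : ν ≤ 8) (hσ : σ ≤ 3 * ν) (hσn : σ ≤ 28) :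
    ∑ b ∈ Finset.range (8 - ν + 1), (28 - σ).choose b * σ.choose (6 - b) ≤ 134596 := by
  interval_cases ν
  interval_cases σ <;> norm_num [Finset.sum_range_succ, Nat.choose]

end ThmN

end PercRepro
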